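import Literature.NumberTheory.Sieve.RankinSmoothNumbers
import Literature.NumberTheory.Sieve.DivisorPowerSums
import Literature.NumberTheory.Sieve.BombieriAsymptoticSieveMertens
import HarnessLib

/-!
# Rankin's method: the reciprocal sum over large smooth numbers

Trunk `AntSieve`.  PROVED (Montgomery–Vaughan, *Multiplicative Number Theory I*, §7.1): the
reciprocal sum over the `k`-smooth numbers beyond `T` is small,

  `∑_{t ≤ N, p ∣ t ⇒ p < k, t > T} 1/t ≤ T^{−δ} ∏_{p<k} (1 − p^{−(1−δ)})⁻¹`  (`0 < δ < 1`),

and with Rankin's choice `δ = 1/log k` the Euler product is only a power of `log k`: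

  `∏_{p<k} (1 − p^{−(1−1/log k)})⁻¹ ≤ C (log k)^{31}`  (`k ≥ 8`),

so that `∑_{t > T smooth} 1/t ≪ (log k)^{31} exp(−log T / log k)`.  This is the smooth-number
tail estimate needed when a sifting condition `(n, P(z)) = 1` is removed by Legendre's formula
`1_{(n,P(z))=1} = ∑_{e ∣ (n, P(z))} μ(e)` and the divisors `e > √y` of `P(z)` are estimated
trivially (Bombieri–Friedlander–Iwaniec, Acta Math. 156 (1986), §15: hypothesis (A₂) for the
sieved Möbius pieces "is a consequence of the Siegel–Walfisz theorem").

* `Literature.NumberTheory.Sieve.sum_rpow_smoothNumbersUpTo_le` — `∑_{t ≤ N, k-smooth} t^{−σ} ≤ ∏_{p<k}(1 − p^{−σ})⁻¹` (`σ > 0`).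
* `Literature.NumberTheory.Sieve.sum_inv_smoothNumbersUpTo_tail_le` — the displayed tail bound.
* `Literature.NumberTheory.Sieve.prod_primesBelow_rankin_le` — the displayed product bound (constant `(e⁵/log 2)(e⁶/log 2)^{30}`).
* `Literature.NumberTheory.Sieve.sum_inv_smoothNumbersUpTo_tail_le_log` — the two combined.

## References

* H. L. Montgomery, R. C. Vaughan, *Multiplicative Number Theory I*, CUP 2007, §7.1.
  [MontgomeryVaughan2007]
* E. Bombieri, J. B. Friedlander, H. Iwaniec, Acta Math. 156 (1986), §15 p. 246.
  [BombieriFriedlanderIwaniecActa1986]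
-/

open Finset Real

namespace Literature.NumberTheory.Sieve

/-- **Rankin, weighted form**: for `σ > 0`, `∑_{1 ≤ t ≤ N, p ∣ t ⇒ p < k} t^{−σ} ≤ ∏_{p<k} (1 − p^{−σ})⁻¹`
(a finite part of the Euler product of the completely multiplicative `t ↦ t^{−σ}` over the
`k`-smooth numbers). [cite: MontgomeryVaughan2007, §7.1 (7.17)] -/
theorem sum_rpow_smoothNumbersUpTo_le (N k : ℕ) {σ : ℝ} (hσ : 0 < σ) :
    ∑ t ∈ Nat.smoothNumbersUpTo N k, (t : ℝ) ^ (-σ) ≤ ∏ p ∈ k.primesBelow, (1 - (p : ℝ) ^ (-σ))⁻¹ := by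
  set f : ℕ →* ℝ := rpowNegHom σ with hf
  have hlt : ∀ {p : ℕ}, p.Prime → ‖f p‖ < 1 := by
    intro p hp
    rw [hf, rpowNegHom_apply, Real.norm_eq_abs, abs_of_nonneg (by positivity)]
    exact Real.rpow_lt_one_of_one_lt_of_neg (by exact_mod_cast hp.one_lt) (by linarith)
  obtain ⟨-, hsum⟩ := EulerProduct.summable_and_hasSum_smoothNumbers_prod_primesBelow_geometric hlt k
  have hprod : ∏ p ∈ k.primesBelow, (1 - f p)⁻¹ = ∏ p ∈ k.primesBelow, (1 - (p : ℝ) ^ (-σ))⁻¹ := by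
    simp [hf]
  rw [← hprod]
  set S := Nat.smoothNumbersUpTo N k with hS
  have hmem : ∀ n ∈ S, n ∈ Nat.smoothNumbers k := fun n hn => (Nat.mem_smoothNumbersUpTo.1 hn).2
  have hsub : ∑ n ∈ S, (n : ℝ) ^ (-σ) = ∑ m ∈ S.subtype (· ∈ Nat.smoothNumbers k), f (m : ℕ) := by
    rw [Finset.sum_subtype_eq_sum_filter, Finset.filter_true_of_mem hmem]
    simp [hf]
  rw [hsub]
  refine sum_le_hasSum _ (fun m _ => ?_) hsum
  simp only [hf, rpowNegHom_apply]
  positivity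

/-- **The reciprocal sum over large smooth numbers**: for `0 < δ < 1` and `T > 0`,
`∑_{t ≤ N, k-smooth, t > T} 1/t ≤ T^{−δ} ∏_{p<k} (1 − p^{−(1−δ)})⁻¹` (`1/t ≤ T^{−δ} t^{−(1−δ)}` for `t > T`).
[cite: MontgomeryVaughan2007, §7.1] -/
theorem sum_inv_smoothNumbersUpTo_tail_le (N k : ℕ) {δ : ℝ} (hδ0 : 0 < δ) (hδ1 : δ < 1) {T : ℝ}
    (hT : 0 < T) :
    ∑ t ∈ (Nat.smoothNumbersUpTo N k).filter (fun t : ℕ => T < (t : ℝ)), ((t : ℝ))⁻¹ ≤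
      T ^ (-δ) * ∏ p ∈ k.primesBelow, (1 - (p : ℝ) ^ (-(1 - δ)))⁻¹ := by
  have hσ : 0 < 1 - δ := by linarith
  calc ∑ t ∈ (Nat.smoothNumbersUpTo N k).filter (fun t : ℕ => T < (t : ℝ)), ((t : ℝ))⁻¹
      ≤ ∑ t ∈ (Nat.smoothNumbersUpTo N k).filter (fun t : ℕ => T < (t : ℝ)), T ^ (-δ) * (t : ℝ) ^ (-(1 - δ)) := by
        refine Finset.sum_le_sum fun t ht => ?_
        have hTt : T < t := (Finset.mem_filter.1 ht).2
        have ht0 : (0 : ℝ) < t := hT.trans hTt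
        -- `t⁻¹ = t^{-δ} t^{-(1-δ)} ≤ T^{-δ} t^{-(1-δ)}`
        have h1 : ((t : ℝ))⁻¹ = (t : ℝ) ^ (-δ) * (t : ℝ) ^ (-(1 - δ)) := by
          rw [← Real.rpow_add ht0, ← Real.rpow_neg_one]; ring_nf
        rw [h1]
        refine mul_le_mul_of_nonneg_right ?_ (by positivity)
        exact Real.rpow_le_rpow_of_nonpos hT hTt.le (by linarith)
    _ = T ^ (-δ) * ∑ t ∈ (Nat.smoothNumbersUpTo N k).filter (fun t : ℕ => T < (t : ℝ)), (t : ℝ) ^ (-(1 - δ)) := by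
        rw [Finset.mul_sum]
    _ ≤ T ^ (-δ) * ∑ t ∈ Nat.smoothNumbersUpTo N k, (t : ℝ) ^ (-(1 - δ)) := by
        refine mul_le_mul_of_nonneg_left ?_ (by positivity)
        exact Finset.sum_le_sum_of_subset_of_nonneg (Finset.filter_subset _ _) fun _ _ _ => by positivity
    _ ≤ T ^ (-δ) * ∏ p ∈ k.primesBelow, (1 - (p : ℝ) ^ (-(1 - δ)))⁻¹ :=
        mul_le_mul_of_nonneg_left (sum_rpow_smoothNumbersUpTo_le N k hσ) (by positivity)

/-- **Rankin's Euler product is a power of `log`**: with `δ = 1/log k` and `k ≥ 8`,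
`∏_{p<k} (1 − p^{−(1−δ)})⁻¹ ≤ (e⁵/log 2)(e⁶/log 2)^{30} (log k)^{31}`.  For `p < k` one has
`p^δ ≤ e`, so for `p ≥ 3` the factor is at most `(1 − 1/p)⁻¹ (p−1)/(p−e) ≤ (1 − 1/p)⁻¹ e^{30/p}`, and
for `p = 2` it is `≤ 4`; then `∏_{p<k}(1 − 1/p)⁻¹ ≤ e⁵ log k / log 2` (tree) and
`exp(∑_{p ≤ k} 1/p) ≤ e⁶ log k / log 2` (`exp_sum_primes_inv_le`). [cite: MontgomeryVaughan2007, §7.1] -/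
theorem prod_primesBelow_rankin_le {k : ℕ} (hk : 8 ≤ k) :
    ∏ p ∈ k.primesBelow, (1 - (p : ℝ) ^ (-(1 - 1 / Real.log k)))⁻¹ ≤
      (Real.exp 5 / Real.log 2) * (Real.exp 6 / Real.log 2) ^ 30 * Real.log k ^ 31 := by
  have hk8 : (8 : ℝ) ≤ k := by exact_mod_cast hk
  have hk2 : (2 : ℝ) ≤ k := by linarith
  have hlogk : 2 < Real.log k := by
    have h8 : Real.log 8 ≤ Real.log k := Real.log_le_log (by norm_num) hk8
    have : (2 : ℝ) < Real.log 8 := by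
      rw [show (8 : ℝ) = 2 ^ 3 by norm_num, Real.log_pow]
      have := Real.log_two_gt_d9
      push_cast
      linarith
    linarith
  have hlogk0 : 0 < Real.log k := by linarith
  set δ : ℝ := 1 / Real.log k with hδ
  have hδ0 : 0 < δ := by positivity
  have hδhalf : δ ≤ 1 / 2 := by
    rw [hδ, div_le_div_iff₀ hlogk0 (by norm_num)]; linarith
  have hlog2 : 0 < Real.log 2 := Real.log_pos one_lt_two
  have he : Real.exp 1 < 2.72 := by
    have := Real.exp_one_lt_d9; linarith
  -- the factorwise bound
  have hfac : ∀ p ∈ k.primesBelow,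
      (1 - (p : ℝ) ^ (-(1 - δ)))⁻¹ ≤ (1 - (p : ℝ)⁻¹)⁻¹ * Real.exp (30 * (p : ℝ)⁻¹) := by
    intro p hp
    obtain ⟨hpk, hpp⟩ := Nat.mem_primesBelow.1 hp
    have hp2 : (2 : ℝ) ≤ p := by exact_mod_cast hpp.two_le
    have hp0 : (0 : ℝ) < p := by linarith
    -- `p^{-(1-δ)} = p^δ / p` and `p^δ ≤ e`
    have hsplit : (p : ℝ) ^ (-(1 - δ)) = (p : ℝ) ^ δ * (p : ℝ)⁻¹ := by
      rw [← Real.rpow_neg_one, ← Real.rpow_add hp0]; ring_nf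
    have hpδ : (p : ℝ) ^ δ ≤ Real.exp 1 := by
      rw [Real.rpow_def_of_pos hp0, Real.exp_le_exp]
      have hlp : Real.log p ≤ Real.log k := Real.log_le_log hp0 (by exact_mod_cast hpk.le)
      have hlp0 : 0 ≤ Real.log p := Real.log_nonneg (by linarith)
      rw [hδ]
      rw [show Real.log p * (1 / Real.log k) = Real.log p / Real.log k by ring]
      exact (div_le_one hlogk0).2 hlp
    have hinv1 : 0 < 1 - (p : ℝ)⁻¹ := sub_pos.2 (inv_lt_one_of_one_lt₀ (by linarith))
    rcases hpp.eq_two_or_odd' with rfl | hodd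
    · -- `p = 2`: the factor is `≤ 4 ≤ 2 e^{15}`
      -- `2^{-1/2} ≤ 3/4` (cf. `Literature.NumberTheory.LFunctions.PartialEuler.two_rpow_neg_half_le`; inlined to avoid a cross-topic import)
      have h234 : (2 : ℝ) ^ (-(1 / 2 : ℝ)) ≤ 3 / 4 := by
        rw [Real.rpow_neg (by norm_num), ← Real.sqrt_eq_rpow]
        rw [inv_le_comm₀ (Real.sqrt_pos.2 (by norm_num)) (by norm_num)]
        rw [show ((3 : ℝ) / 4)⁻¹ = 4 / 3 by norm_num]
        rw [Real.le_sqrt (by norm_num) (by norm_num)]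
        norm_num
      have hu : (2 : ℝ) ^ (-(1 - δ)) ≤ 3 / 4 := by
        calc (2 : ℝ) ^ (-(1 - δ)) ≤ (2 : ℝ) ^ (-(1 / 2 : ℝ)) :=
              Real.rpow_le_rpow_of_exponent_le (by norm_num) (by linarith)
          _ ≤ 3 / 4 := h234
      have h4 : (1 - (2 : ℝ) ^ (-(1 - δ)))⁻¹ ≤ 4 := by
        rw [inv_eq_one_div, div_le_iff₀ (by linarith)]; linarith
      refine h4.trans ?_
      push_cast
      have h15 : (4 : ℝ) ≤ Real.exp (30 * (2 : ℝ)⁻¹) := by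
        have := Real.add_one_le_exp (30 * (2 : ℝ)⁻¹); norm_num at this ⊢; linarith
      have h2' : (1 : ℝ) ≤ (1 - (2 : ℝ)⁻¹)⁻¹ := by norm_num
      nlinarith [Real.exp_pos (30 * (2:ℝ)⁻¹)]
    · -- `p ≥ 3`
      have hp3 : (3 : ℝ) ≤ p := by
        have : 3 ≤ p := by
          rcases hodd with ⟨m, hm⟩
          have := hpp.two_le; omega
        exact_mod_cast this
      have hu : (p : ℝ) ^ (-(1 - δ)) ≤ Real.exp 1 * (p : ℝ)⁻¹ := by
        rw [hsplit]; exact mul_le_mul_of_nonneg_right hpδ (by positivity)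
      have hue : Real.exp 1 * (p : ℝ)⁻¹ < 1 := by
        rw [← div_eq_mul_inv, div_lt_one hp0]; linarith
      -- `(1 - u)⁻¹ ≤ (1 - e/p)⁻¹ = p/(p - e)`
      have h1 : (1 - (p : ℝ) ^ (-(1 - δ)))⁻¹ ≤ (1 - Real.exp 1 * (p : ℝ)⁻¹)⁻¹ :=
        inv_anti₀ (by linarith) (by linarith)
      refine h1.trans ?_
      -- `p/(p-e) ≤ (p/(p-1)) (1 + 30/p) ≤ (p/(p-1)) e^{30/p}`
      have hpe : 0 < (p : ℝ) - Real.exp 1 := by linarith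
      have hform1 : (1 - Real.exp 1 * (p : ℝ)⁻¹)⁻¹ = p / (p - Real.exp 1) := by
        field_simp
      have hform2 : (1 - (p : ℝ)⁻¹)⁻¹ = p / (p - 1) := by
        field_simp
      rw [hform1, hform2]
      have hp1 : 0 < (p : ℝ) - 1 := by linarith
      have hstep : (p : ℝ) / (p - Real.exp 1) ≤ p / (p - 1) * (1 + 30 * (p : ℝ)⁻¹) := by
        rw [div_le_iff₀ hpe]
        rw [show (p : ℝ) / (p - 1) * (1 + 30 * (p : ℝ)⁻¹) * (p - Real.exp 1) =
          (p * (1 + 30 * (p : ℝ)⁻¹) * (p - Real.exp 1)) / (p - 1) by ring]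
        rw [le_div_iff₀ hp1]
        have hexp0 : 0 < Real.exp 1 := Real.exp_pos 1
        have : (p : ℝ) * (1 + 30 * (p : ℝ)⁻¹) = p + 30 := by field_simp
        rw [this]
        nlinarith
      refine hstep.trans (mul_le_mul_of_nonneg_left ?_ (div_nonneg hp0.le hp1.le))
      linarith [Real.add_one_le_exp (30 * (p : ℝ)⁻¹)]
  -- multiply out
  have hpos : ∀ p ∈ k.primesBelow, 0 ≤ (1 - (p : ℝ) ^ (-(1 - δ)))⁻¹ := by
    intro p hp
    have hpp := (Nat.mem_primesBelow.1 hp).2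
    have : (p : ℝ) ^ (-(1 - δ)) < 1 :=
      Real.rpow_lt_one_of_one_lt_of_neg (by exact_mod_cast hpp.one_lt) (by linarith)
    exact inv_nonneg.2 (by linarith)
  calc ∏ p ∈ k.primesBelow, (1 - (p : ℝ) ^ (-(1 - δ)))⁻¹
      ≤ ∏ p ∈ k.primesBelow, ((1 - (p : ℝ)⁻¹)⁻¹ * Real.exp (30 * (p : ℝ)⁻¹)) :=
        Finset.prod_le_prod hpos hfac
    _ = (∏ p ∈ k.primesBelow, (1 - (p : ℝ)⁻¹)⁻¹) * Real.exp (30 * ∑ p ∈ k.primesBelow, (p : ℝ)⁻¹) := by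
        rw [Finset.prod_mul_distrib, Finset.mul_sum, Real.exp_sum]
    _ ≤ (Real.exp 5 * Real.log k / Real.log 2) * (Real.exp 6 * Real.log k / Real.log 2) ^ 30 := by
        have hP1 : ∏ p ∈ k.primesBelow, (1 - (p : ℝ)⁻¹)⁻¹ ≤ Real.exp 5 * Real.log k / Real.log 2 := by
          have h0 := BombieriSieve.prod_primesGe_one_sub_inv_inv_le (z := 2) (x := (k : ℝ)) le_rfl hk2
          refine le_trans ?_ h0
          have hfl : ⌊(k : ℝ)⌋₊ = k := Nat.floor_natCast k
          apply Finset.prod_le_prod_of_subset_of_one_le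
          · intro p hp
            obtain ⟨hpk, hpp⟩ := Nat.mem_primesBelow.1 hp
            have h2p : (2 : ℝ) ≤ (p : ℝ) := by exact_mod_cast hpp.two_le
            have hpk' : p ≤ ⌊(k : ℝ)⌋₊ := by rw [hfl]; exact hpk.le
            exact BombieriSieve.mem_primesGe.2 ⟨hpp, h2p, hpk'⟩
          · intro p _
            exact inv_nonneg.2 (sub_nonneg.2 (Nat.cast_inv_le_one p))
          · intro p hp _
            have hpp : p.Prime := (BombieriSieve.mem_primesGe.1 hp).1
            have hp1 : (1 : ℝ) < p := by exact_mod_cast hpp.one_lt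
            exact (one_le_inv₀ (sub_pos.2 (inv_lt_one_of_one_lt₀ hp1))).2
              (sub_le_self _ (inv_nonneg.2 (Nat.cast_nonneg p)))
        have hP2 : Real.exp (30 * ∑ p ∈ k.primesBelow, (p : ℝ)⁻¹) ≤
            (Real.exp 6 * Real.log k / Real.log 2) ^ 30 := by
          have h0 := exp_sum_primes_inv_le hk2
          rw [Nat.floor_natCast] at h0
          have hsub : ∑ p ∈ k.primesBelow, (p : ℝ)⁻¹ ≤ ∑ p ∈ (Icc 1 k).filter Nat.Prime, (p : ℝ)⁻¹ := by
            refine Finset.sum_le_sum_of_subset_of_nonneg (fun p hp => ?_) (fun _ _ _ => by positivity)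
            obtain ⟨hpk, hpp⟩ := Nat.mem_primesBelow.1 hp
            exact Finset.mem_filter.2 ⟨Finset.mem_Icc.2 ⟨hpp.one_lt.le, hpk.le⟩, hpp⟩
          have h30 : Real.exp (30 * ∑ p ∈ k.primesBelow, (p : ℝ)⁻¹) =
              Real.exp (∑ p ∈ k.primesBelow, (p : ℝ)⁻¹) ^ 30 := by
            rw [← Real.exp_nat_mul]; norm_num
          rw [h30]
          exact pow_le_pow_left₀ (Real.exp_pos _).le ((Real.exp_le_exp.2 hsub).trans h0) 30
        exact mul_le_mul hP1 hP2 (by positivity) (by positivity)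
    _ = (Real.exp 5 / Real.log 2) * (Real.exp 6 / Real.log 2) ^ 30 * Real.log k ^ 31 := by
        rw [mul_div_right_comm, mul_div_right_comm (Real.exp 6), mul_pow]; ring

/-- **Rankin's tail bound in the `log` currency**: for `k ≥ 8`, `T > 0` and all `N`,
`∑_{t ≤ N, k-smooth, t > T} 1/t ≤ (e⁵/log 2)(e⁶/log 2)^{30} (log k)^{31} exp(−log T / log k)`.
[cite: MontgomeryVaughan2007, §7.1] -/
theorem sum_inv_smoothNumbersUpTo_tail_le_log (N : ℕ) {k : ℕ} (hk : 8 ≤ k) {T : ℝ} (hT : 0 < T) :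
    ∑ t ∈ (Nat.smoothNumbersUpTo N k).filter (fun t : ℕ => T < (t : ℝ)), ((t : ℝ))⁻¹ ≤
      (Real.exp 5 / Real.log 2) * (Real.exp 6 / Real.log 2) ^ 30 * Real.log k ^ 31 *
        Real.exp (-(Real.log T / Real.log k)) := by
  have hk8 : (8 : ℝ) ≤ k := by exact_mod_cast hk
  have hlogk : 2 < Real.log k := by
    have h8 : Real.log 8 ≤ Real.log k := Real.log_le_log (by norm_num) hk8
    have : (2 : ℝ) < Real.log 8 := by
      rw [show (8 : ℝ) = 2 ^ 3 by norm_num, Real.log_pow]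
      have := Real.log_two_gt_d9
      push_cast
      linarith
    linarith
  have hδ0 : 0 < 1 / Real.log k := by positivity
  have hδ1 : 1 / Real.log k < 1 := by rw [div_lt_one (by linarith)]; linarith
  have h := sum_inv_smoothNumbersUpTo_tail_le N k hδ0 hδ1 hT
  have hexp : T ^ (-(1 / Real.log k)) = Real.exp (-(Real.log T / Real.log k)) := by
    rw [Real.rpow_def_of_pos hT]; congr 1; ring
  rw [hexp] at h
  refine h.trans ?_
  rw [mul_comm]
  exact mul_le_mul_of_nonneg_right (prod_primesBelow_rankin_le hk) (Real.exp_pos _).le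

end Literature.NumberTheory.Sieve
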